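import Literature.NumberTheory.Automorphic.ReductiveGLn
import Literature.NumberTheory.Automorphic.ParabolicGL
import Literature.NumberTheory.Automorphic.SubgroupIndexDevissage
import Mathlib.GroupTheory.Index
import HarnessLib

/-!
# The entry-by-entry filtration of the unitriangular group `U_n ≤ GL_n(F)` (Weir's partition subgroups) and the index
# of a subgroup computed entry by entry (Weir 1955; Mazza §2; Laumon (4.1.3)–(4.1.4); Cartier §I.3)

Topic `NumberTheory/Automorphic`; namespace `Literature.NumberTheory.Automorphic` (lane `lit-hodgefound`, Track 2
foundations; seat `lit-hodgefound-p11`, generation 47, row g47-#1).  DEFINITIONS WITH BODIES (`entryLevel`,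
`unitriangularFiltration`, `entryHom`) + theorems; no named fact, no instance, no notation.  The `GL_n`-generic engine
behind the EVALUATION of the modulus index `[K_P : K_P ∩ tK_Pt⁻¹]` of the unramified unitary groups `U(σ, J₀)` for every
`N` (sequel `UnitaryBorelModulusIndex`, g47-#2; the index was left abstract by `HyperspecialUnitarySatakeDuality`,
g44-#3, and computed for `N = 2, 3` only by `UnitaryRankOneBorelModulusIndex`, g46-#2).

## The mathematics

Order the positions `(i, j)`, `i < j`, of an `n × n` matrix by the LEVEL `ℓ(i, j) = i + n (j - i - 1)` (first by the
distance `j - i` to the diagonal, then by the row); `ℓ` is injective on `{i < j}` and `ℓ(i, l), ℓ(l, j) < ℓ(i, j)` for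
`i < l < j` (§2).  For `m ∈ ℕ` let `U_m ≤ U_n(F)` be the upper unitriangular matrices `g` with `g_{ij} = 0` whenever
`i < j` and `ℓ(i, j) < m` (§3, `unitriangularFiltration n F m`): `U_0 = U_n(F)`, `U_{m+1} ≤ U_m`, `U_m = 1` for
`m ≥ n²`, and `U_{m+1} = U_m ∩ {g_{ij} = 0}` if `ℓ(i, j) = m` (`U_{m+1} = U_m` if `m` is not a level).  This is a
refinement of the lower central series of `U_n(F)` into steps with ONE-dimensional quotients: for `g, h ∈ U_m` and
`ℓ(i, j) ≤ m` one has `(gh)_{ij} = g_{ij} + h_{ij}` and `(g⁻¹)_{ij} = -g_{ij}` (§4: in `∑_l g_{il} h_{lj}` only `l = i` and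
`l = j` survive), so the `(i, j)`-entry is a homomorphism `U_{ℓ(i,j)} → F` (`entryHom i j`) with kernel `U_{ℓ(i,j)+1}`.
Consequently (§1 + §4), for subgroups `B ≤ A` of `GL_n(F)` and every position `(i, j)` of level `ℓ`,

  `[A ∩ U_ℓ : B ∩ U_ℓ] = [e_{ij}(A ∩ U_ℓ) : e_{ij}(B ∩ U_ℓ)] · [A ∩ U_{ℓ+1} : B ∩ U_{ℓ+1}]`

(`relIndex_inf_unitriangularFiltration_eq_mul`; the abstract step is `[A : B] = [f(A) : f(B)]·[ker f : B ∩ ker f]` for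
a homomorphism `f` on `A`, `relIndex_eq_relIndex_map_mul_relIndex_ker`), and the index of `B` in `A` (both inside
`U_n(F)`) is the product over all positions of the indices of the entry groups — Laumon's computation of the modulus
`δ_B = ∏_{α > 0} |α|` root group by root group, for an arbitrary subgroup in place of the integral points.  §5 records the
matrices of the products of elementary unipotents `t_{ij}(a) = 1 + aE_{ij}` (`transvectionGL`) used as root elements:
`t_{ij}(a) t_{i'j'}(b) = 1 + aE_{ij} + bE_{i'j'}` (`j ≠ i'`) and `t_{ic}(a) t_{ck}(b) t_{ik}(d) = 1 + aE_{ic} + bE_{ck} + (ab + d)E_{ik}`,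
and an entrywise membership criterion for `U_m`.

## What is formalised

* §1 **`relIndex_eq_relIndex_map_mul_relIndex_ker`** (`[A : B] = [f(A) : f(B)]·[ker f : B ∩ ker f]`).
* §2 `entryLevel` (def), `entryLevel_lt_mul_self`, `entryLevel_lt_right`, `entryLevel_lt_left`, `entryLevel_inj`,
  `entryLevel_lt_entryLevel_of_lt`, `val_rev_sub_val_rev`, `entryLevel_lt_entryLevel_rev`, `entryLevel_rev_lt_entryLevel`.
* §3 `mul_apply_eq_add` (the survivor computation), `unitriangularFiltration` (def), `mem_unitriangularFiltration_iff`,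
  `unitriangularFiltration_le_upperUnitriangular`, `unitriangularFiltration_zero`, `unitriangularFiltration_antitone`,
  `apply_self_of_mem_unitriangularFiltration`, `apply_of_gt_of_mem_unitriangularFiltration`,
  `apply_of_entryLevel_lt_of_mem`, `mem_unitriangularFiltration_of_apply`, `eq_one_of_mem_unitriangularFiltration`,
  `unitriangularFiltration_eq_bot`, `mem_unitriangularFiltration_succ_iff`, `unitriangularFiltration_succ_eq_of_forall_ne`,
  `mem_unitriangularFiltration_entryLevel_succ_iff`.
* §4 `mul_apply_eq_add_of_mem`, `inv_apply_eq_neg_of_mem`, `entryHom` (def), `toAdd_entryHom`, `mem_ker_entryHom_iff`,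
  `ker_entryHom`, `mem_map_entryHom_iff`, **`relIndex_inf_unitriangularFiltration_eq_mul`**,
  `relIndex_inf_unitriangularFiltration_succ_eq_of_forall_ne`, `relIndex_inf_unitriangularFiltration_zero`,
  `relIndex_inf_unitriangularFiltration_of_mul_self_le`.
* §5 `coe_transvectionGL_mul_transvectionGL_of_ne`, `coe_transvectionGL_mul_transvectionGL_mul_transvectionGL`,
  `coe_transvectionGL_eq_one_add`, `one_add_apply_of_forall`, `one_add_apply_of_ne`,
  `mem_unitriangularFiltration_of_coe_eq_one_add`.

## References
* [Weir1955] A. J. Weir, *Sylow p-subgroups of the general linear group over finite fields of characteristic p*,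
  Proc. AMS 6 (1955) 454–464 (partition subgroups of the unitriangular group, «completing the rectangle»).
* [Mazza2017] N. Mazza, *The pro-p group of upper unitriangular matrices*, J. Pure Appl. Algebra (2017),
  arXiv:1701.03024, §2 Def. 2.1 (partition diagrams `μ`, partition subgroups `P_μ = {x : x_{ij} = 0 ∀ (i,j) ∉ μ}`),
  §2 (1) (`[1 + ae_{ij}, 1 + be_{kl}] = 1 + δ_{jk} ab e_{il} - δ_{il} ab e_{kj}`, `(1 + ae_{ij})(1 + be_{jk}) = 1 + ae_{ij} + be_{jk} + ab e_{ik}`).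
* [Laumon1995] G. Laumon, *Cohomology of Drinfeld Modular Varieties I*, CUP (1996), (4.1.3)–(4.1.4) (the modulus
  `δ_B(b) = ∏_{i<j} |b_{ii}/b_{jj}|` computed root group by root group).
* [CartierCorvallis1979] P. Cartier, *Representations of 𝔭-adic groups: a survey*, PSPM 33.1 (1979), §I.3 (indices of
  commensurable compact open subgroups), §IV (4.2).
* [GetzHahn2024] J. Getz, H. Hahn, *An Introduction to Automorphic Representations*, GTM 300 (2024), Prop. 3.5.1 and
  (7.19) p. 140 (`δ_B(b) = |det Ad(b)|`).
* [Macdonald1995] I. G. Macdonald, *Symmetric Functions and Hall Polynomials*, 2nd ed. (1995), Ch. V (2.6)–(2.7).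
* [BruhatTits1972] F. Bruhat, J. Tits, *Groupes réductifs sur un corps local I*, Publ. Math. IHÉS 41 (1972), §6.1
  (filtrations of root groups), (4.4.4).
-/

open scoped MatrixGroups Pointwise

namespace Literature.NumberTheory.Automorphic

/-! ## §1 The index step `[A : B] = [f(A) : f(B)]·[ker f : B ∩ ker f]` -/

section IndexStep

variable {G M : Type*} [Group G] [Group M]

/-- **`[A : A ∩ B] = [f(A) : f(A ∩ B)] · [ker f : ker f ∩ B]`** for a homomorphism `f` defined on `A`: the subgroup
`C = f⁻¹(f(B)) = B · ker f` sits between `B` and `A` with `[A : C] = [f(A) : f(B)]` and `[C : B] = [ker f : ker f ∩ B]`.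
This is how the index of an open compact subgroup in another is computed along a filtration with abelian
(here: arbitrary) quotients. [cite: CartierCorvallis1979, §I.3] [cite: Laumon1995, (4.1.3)–(4.1.4)] -/
theorem relIndex_eq_relIndex_map_mul_relIndex_ker (A B : Subgroup G) (f : ↥A →* M) :
    B.relIndex A = ((B.subgroupOf A).map f).relIndex f.range * (B.subgroupOf A ⊓ f.ker).relIndex f.ker := by
  set B' := B.subgroupOf A with hB'
  set C := (B'.map f).comap f with hC
  have hB'C : B' ≤ C := Subgroup.le_comap_map f B'
  have hkerC : f.ker ≤ C := by
    rw [hC, ← MonoidHom.comap_bot]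
    exact Subgroup.comap_mono bot_le
  have h1 : C.index = (B'.map f).relIndex f.range := Subgroup.index_comap _ _
  have h2 : B'.relIndex C = (B' ⊓ f.ker).relIndex f.ker := by
    have hsub : (C : Set A) ⊆ (f.ker : Set A) * (B' : Set A) := by
      intro x hx
      obtain ⟨b, hb, hbx⟩ := Subgroup.mem_map.1 (Subgroup.mem_comap.1 hx)
      refine Set.mem_mul.2 ⟨x * b⁻¹, ?_, b, hb, inv_mul_cancel_right x b⟩
      rw [SetLike.mem_coe, MonoidHom.mem_ker, map_mul, map_inv, ← hbx, mul_inv_cancel]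
    rw [relIndex_eq_relIndex_of_coe_subset_mul hkerC hsub, Subgroup.inf_relIndex_right]
  rw [Subgroup.relIndex, ← hB', ← Subgroup.relIndex_mul_index hB'C, h1, h2, mul_comm]

end IndexStep

/-! ## §2 The level `ℓ(i, j) = i + n (j - i - 1)` of a position -/

section Levels

variable {n : ℕ}

/-- **The level of the position `(i, j)`** (`i < j`): `ℓ(i, j) = i + n (j - i - 1)` — positions are ordered first by the
distance `j - i` to the diagonal, then by the row; `{ℓ ≥ m}` is a partition diagram for every `m`. [cite: Mazza2017, Def. 2.1]
[cite: BruhatTits1972, §6.1] -/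
def entryLevel (i j : Fin n) : ℕ := (i : ℕ) + n * ((j : ℕ) - i - 1)

/-- The definition unfolded. [cite: Mazza2017, Def. 2.1] -/
theorem entryLevel_def (i j : Fin n) : entryLevel i j = (i : ℕ) + n * ((j : ℕ) - i - 1) := rfl

/-- Levels are `< n²`. [cite: Mazza2017, Def. 2.1] -/
theorem entryLevel_lt_mul_self (i j : Fin n) : entryLevel i j < n * n := by
  have hi := i.2
  have hj := j.2
  rw [entryLevel_def]
  have h1 : (j : ℕ) - i - 1 ≤ n - 1 := by omega
  calc (i : ℕ) + n * ((j : ℕ) - i - 1) ≤ (i : ℕ) + n * (n - 1) := by gcongr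
    _ < n + n * (n - 1) := by omega
    _ = n * n := by
        obtain ⟨k, hk⟩ : ∃ k, n = k + 1 := ⟨n - 1, by omega⟩
        subst hk
        simp only [Nat.add_sub_cancel]
        ring

/-- `ℓ(i, l) < ℓ(i, j)` for `i < l < j` (a position to the left in the same row has smaller level). [cite: Mazza2017, Def. 2.1] -/
theorem entryLevel_lt_right {i l j : Fin n} (hil : i < l) (hlj : l < j) : entryLevel i l < entryLevel i j := by
  rw [entryLevel_def, entryLevel_def, Fin.lt_def] at *
  have hn : 0 < n := lt_of_le_of_lt (Nat.zero_le _) j.2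
  have h : (l : ℕ) - i - 1 < (j : ℕ) - i - 1 := by omega
  have := Nat.mul_lt_mul_of_pos_left h hn
  omega

/-- `ℓ(l, j) < ℓ(i, j)` for `i < l < j` (a position below in the same column has smaller level). [cite: Mazza2017, Def. 2.1] -/
theorem entryLevel_lt_left {i l j : Fin n} (hil : i < l) (hlj : l < j) : entryLevel l j < entryLevel i j := by
  rw [entryLevel_def, entryLevel_def]
  rw [Fin.lt_def] at hil hlj
  have hl := l.2
  have h : (j : ℕ) - l - 1 + 1 ≤ (j : ℕ) - i - 1 := by omega
  have h' := Nat.mul_le_mul_left n h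
  rw [Nat.mul_add, mul_one] at h'
  omega

/-- **Levels separate positions**: `ℓ(i, j) = ℓ(i', j')` with `i < j`, `i' < j'` forces `(i, j) = (i', j')`
(`ℓ mod n` is the row, `ℓ div n` the distance to the diagonal minus one). [cite: Mazza2017, Def. 2.1] -/
theorem entryLevel_inj {i j i' j' : Fin n} (hij : i < j) (hij' : i' < j') (h : entryLevel i j = entryLevel i' j') :
    i = i' ∧ j = j' := by
  have hn : 0 < n := lt_of_le_of_lt (Nat.zero_le _) j.2
  rw [entryLevel_def, entryLevel_def] at h
  have hmod := congrArg (· % n) h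
  have hdiv := congrArg (· / n) h
  simp only [Nat.add_mul_mod_self_left, Nat.mod_eq_of_lt i.2, Nat.mod_eq_of_lt i'.2] at hmod
  simp only [Nat.add_mul_div_left _ _ hn, Nat.div_eq_of_lt i.2, Nat.div_eq_of_lt i'.2, zero_add] at hdiv
  rw [Fin.lt_def] at hij hij'
  refine ⟨Fin.ext hmod, Fin.ext ?_⟩
  omega

/-- Positions at the same distance to the diagonal are ordered by their row. [cite: Mazza2017, Def. 2.1] -/
theorem entryLevel_lt_entryLevel_of_lt {i j i' j' : Fin n} (hd : (j : ℕ) - i = (j' : ℕ) - i') (h : i < i') :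
    entryLevel i j < entryLevel i' j' := by
  rw [entryLevel_def, entryLevel_def, hd]
  rw [Fin.lt_def] at h
  omega

/-- The partner position `(rev j, rev i)` of `(i, j)` lies at the same distance to the diagonal:
`rev i - rev j = j - i`. [cite: Mazza2017, Def. 2.1] -/
theorem val_rev_sub_val_rev (i j : Fin n) : ((Fin.rev i : Fin n) : ℕ) - (Fin.rev j : Fin n) = (j : ℕ) - i := by
  rw [Fin.val_rev, Fin.val_rev]
  have hi := i.2
  have hj := j.2
  omega

/-- `ℓ(i, j) < ℓ(rev j, rev i)` when `i < rev j` (the position lies strictly above the antidiagonal). [cite: Mazza2017, Def. 2.1] -/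
theorem entryLevel_lt_entryLevel_rev {i j : Fin n} (h : i < Fin.rev j) :
    entryLevel i j < entryLevel (Fin.rev j) (Fin.rev i) :=
  entryLevel_lt_entryLevel_of_lt (val_rev_sub_val_rev i j).symm h

/-- `ℓ(rev j, rev i) < ℓ(i, j)` when `rev j < i` (the position lies strictly below the antidiagonal). [cite: Mazza2017, Def. 2.1] -/
theorem entryLevel_rev_lt_entryLevel {i j : Fin n} (h : Fin.rev j < i) :
    entryLevel (Fin.rev j) (Fin.rev i) < entryLevel i j :=
  entryLevel_lt_entryLevel_of_lt (val_rev_sub_val_rev i j) h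

end Levels

/-! ## §3 The filtration `U_m = {g ∈ U_n(F) : g_{ij} = 0 for i < j, ℓ(i, j) < m}` -/

section Filtration

variable {F : Type*} [Field F] {n : ℕ}

/-- **The survivor computation**: for upper unitriangular `g, h` and `i < j` such that `g_{il} h_{lj} = 0` for all
`i < l < j`, `(gh)_{ij} = g_{ij} + h_{ij}` (only `l = i` and `l = j` survive in `∑_l g_{il} h_{lj}`).
[cite: BruhatTits1972, §6.1] -/
theorem mul_apply_eq_add {g h : GL (Fin n) F} (hg : g ∈ upperUnitriangular (Fin n) F)
    (hh : h ∈ upperUnitriangular (Fin n) F) {i j : Fin n} (hij : i < j)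
    (h0 : ∀ l, i < l → l < j → (g : Matrix (Fin n) (Fin n) F) i l * (h : Matrix (Fin n) (Fin n) F) l j = 0) :
    ((g * h : GL (Fin n) F) : Matrix (Fin n) (Fin n) F) i j =
      (g : Matrix (Fin n) (Fin n) F) i j + (h : Matrix (Fin n) (Fin n) F) i j := by
  obtain ⟨hgT, hgd⟩ := (mem_upperUnitriangular_iff g).1 hg
  obtain ⟨hhT, hhd⟩ := (mem_upperUnitriangular_iff h).1 hh
  rw [Units.val_mul, Matrix.mul_apply, Fintype.sum_eq_add i j hij.ne, hgd, hhd, one_mul, mul_one, add_comm]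
  rintro l ⟨hli, hlj⟩
  rcases lt_or_gt_of_ne hli with h1 | h1
  · rw [hgT h1, zero_mul]
  · rcases lt_or_gt_of_ne hlj with h2 | h2
    · exact h0 l h1 h2
    · rw [hhT h2, mul_zero]

/-- **The entry filtration `U_m ≤ GL_n(F)`**: upper unitriangular matrices whose entries at the positions of level `< m`
vanish — the PARTITION SUBGROUP (Weir) of the partition diagram `{(i, j) : i < j, ℓ(i, j) ≥ m}` (closed under
`(i, j), (j, k) ↦ (i, k)` since `ℓ(i, k) > ℓ(i, j), ℓ(j, k)`).  `U_0 = U_n(F)`, and `U_{m+1}` is `U_m` with one more entry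
killed (if `m` is a level); a refinement of the lower central series of `U_n(F)`. [cite: Mazza2017, Def. 2.1]
[cite: BruhatTits1972, §6.1] [cite: Laumon1995, (4.1.3)–(4.1.4)] -/
def unitriangularFiltration (n : ℕ) (F : Type*) [Field F] (m : ℕ) : Subgroup (GL (Fin n) F) where
  carrier := {g | g ∈ upperUnitriangular (Fin n) F ∧
    ∀ i j : Fin n, i < j → entryLevel i j < m → (g : Matrix (Fin n) (Fin n) F) i j = 0}
  one_mem' := ⟨(upperUnitriangular (Fin n) F).one_mem, fun i j hij _ => by
    rw [Units.val_one, Matrix.one_apply_ne hij.ne]⟩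
  mul_mem' := by
    rintro g h ⟨hg, hg0⟩ ⟨hh, hh0⟩
    refine ⟨(upperUnitriangular (Fin n) F).mul_mem hg hh, fun i j hij hm => ?_⟩
    rw [mul_apply_eq_add hg hh hij fun l hil hlj => by
      rw [hg0 i l hil ((entryLevel_lt_right hil hlj).trans hm), zero_mul], hg0 i j hij hm, hh0 i j hij hm, add_zero]
  inv_mem' := by
    rintro g ⟨hg, hg0⟩
    refine ⟨(upperUnitriangular (Fin n) F).inv_mem hg, fun i j hij hm => ?_⟩
    have h := mul_apply_eq_add ((upperUnitriangular (Fin n) F).inv_mem hg) hg hij fun l hil hlj => by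
      rw [hg0 l j hlj ((entryLevel_lt_left hil hlj).trans hm), mul_zero]
    rwa [inv_mul_cancel, Units.val_one, Matrix.one_apply_ne hij.ne, hg0 i j hij hm, add_zero, eq_comm] at h

/-- Membership in `U_m`. [cite: BruhatTits1972, §6.1] -/
theorem mem_unitriangularFiltration_iff {m : ℕ} {g : GL (Fin n) F} :
    g ∈ unitriangularFiltration n F m ↔ g ∈ upperUnitriangular (Fin n) F ∧
      ∀ i j : Fin n, i < j → entryLevel i j < m → (g : Matrix (Fin n) (Fin n) F) i j = 0 := Iff.rfl

/-- `U_m ≤ U_n(F)`. [cite: BruhatTits1972, §6.1] -/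
theorem unitriangularFiltration_le_upperUnitriangular (m : ℕ) :
    unitriangularFiltration n F m ≤ upperUnitriangular (Fin n) F := fun _ hg => hg.1

/-- `U_0 = U_n(F)`. [cite: BruhatTits1972, §6.1] -/
theorem unitriangularFiltration_zero : unitriangularFiltration n F 0 = upperUnitriangular (Fin n) F :=
  le_antisymm (unitriangularFiltration_le_upperUnitriangular 0) fun _ hg => ⟨hg, fun _ _ _ h => absurd h (Nat.not_lt_zero _)⟩

/-- The filtration is decreasing: `U_{m'} ≤ U_m` for `m ≤ m'`. [cite: BruhatTits1972, §6.1] -/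
theorem unitriangularFiltration_antitone : Antitone (unitriangularFiltration n F) :=
  fun _ _ hmm' _ hg => ⟨hg.1, fun i j hij hm => hg.2 i j hij (lt_of_lt_of_le hm hmm')⟩

/-- Diagonal entries of elements of `U_m` are `1`. [cite: Mazza2017, Def. 2.1] -/
theorem apply_self_of_mem_unitriangularFiltration {m : ℕ} {g : GL (Fin n) F} (hg : g ∈ unitriangularFiltration n F m)
    (i : Fin n) : (g : Matrix (Fin n) (Fin n) F) i i = 1 :=
  ((mem_upperUnitriangular_iff g).1 hg.1).2 i

/-- Entries below the diagonal of elements of `U_m` vanish. [cite: Mazza2017, Def. 2.1] -/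
theorem apply_of_gt_of_mem_unitriangularFiltration {m : ℕ} {g : GL (Fin n) F}
    (hg : g ∈ unitriangularFiltration n F m) {i j : Fin n} (hji : j < i) : (g : Matrix (Fin n) (Fin n) F) i j = 0 :=
  ((mem_upperUnitriangular_iff g).1 hg.1).1 hji

/-- Entries at positions of level `< m` of elements of `U_m` vanish. [cite: BruhatTits1972, §6.1] -/
theorem apply_of_entryLevel_lt_of_mem {m : ℕ} {g : GL (Fin n) F} (hg : g ∈ unitriangularFiltration n F m)
    {i j : Fin n} (hij : i < j) (hm : entryLevel i j < m) : (g : Matrix (Fin n) (Fin n) F) i j = 0 :=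
  hg.2 i j hij hm

/-- **Entrywise membership criterion** for `U_m`: unit diagonal, zero below the diagonal, zero at the positions of
level `< m`. [cite: BruhatTits1972, §6.1] -/
theorem mem_unitriangularFiltration_of_apply {m : ℕ} {g : GL (Fin n) F}
    (hdiag : ∀ i, (g : Matrix (Fin n) (Fin n) F) i i = 1)
    (hlow : ∀ i j : Fin n, j < i → (g : Matrix (Fin n) (Fin n) F) i j = 0)
    (hlev : ∀ i j : Fin n, i < j → entryLevel i j < m → (g : Matrix (Fin n) (Fin n) F) i j = 0) :
    g ∈ unitriangularFiltration n F m :=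
  ⟨(mem_upperUnitriangular_iff g).2 ⟨fun _ _ hji => hlow _ _ hji, hdiag⟩, hlev⟩

/-- An element of `U_m`, `m ≥ n²`, is the identity (every position has level `< n²`). [cite: Mazza2017, Def. 2.1] -/
theorem eq_one_of_mem_unitriangularFiltration {m : ℕ} (hm : n * n ≤ m) {g : GL (Fin n) F}
    (hg : g ∈ unitriangularFiltration n F m) : g = 1 := by
  refine Units.ext (Matrix.ext fun i j => ?_)
  rw [Units.val_one]
  rcases lt_trichotomy i j with h | rfl | h
  · rw [apply_of_entryLevel_lt_of_mem hg h ((entryLevel_lt_mul_self i j).trans_le hm), Matrix.one_apply_ne h.ne]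
  · rw [apply_self_of_mem_unitriangularFiltration hg, Matrix.one_apply_eq]
  · rw [apply_of_gt_of_mem_unitriangularFiltration hg h, Matrix.one_apply_ne h.ne']

/-- **`U_m = 1` for `m ≥ n²`.** [cite: BruhatTits1972, §6.1] -/
theorem unitriangularFiltration_eq_bot {m : ℕ} (hm : n * n ≤ m) : unitriangularFiltration n F m = ⊥ :=
  (Subgroup.eq_bot_iff_forall _).2 fun _ hg => eq_one_of_mem_unitriangularFiltration hm hg

/-- **`U_{m+1} = U_m ∩ {g_{ij} = 0 : ℓ(i, j) = m}`.** [cite: BruhatTits1972, §6.1] -/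
theorem mem_unitriangularFiltration_succ_iff {m : ℕ} {g : GL (Fin n) F} :
    g ∈ unitriangularFiltration n F (m + 1) ↔ g ∈ unitriangularFiltration n F m ∧
      ∀ i j : Fin n, i < j → entryLevel i j = m → (g : Matrix (Fin n) (Fin n) F) i j = 0 := by
  constructor
  · intro hg
    exact ⟨unitriangularFiltration_antitone (Nat.le_succ m) hg, fun i j hij hm => hg.2 i j hij (by omega)⟩
  · rintro ⟨hg, h⟩
    refine ⟨hg.1, fun i j hij hm => ?_⟩
    rcases Nat.lt_succ_iff_lt_or_eq.1 hm with hm' | hm'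
    · exact hg.2 i j hij hm'
    · exact h i j hij hm'

/-- If `m` is not a level then `U_{m+1} = U_m`. [cite: Mazza2017, Def. 2.1] -/
theorem unitriangularFiltration_succ_eq_of_forall_ne {m : ℕ} (h : ∀ i j : Fin n, i < j → entryLevel i j ≠ m) :
    unitriangularFiltration n F (m + 1) = unitriangularFiltration n F m :=
  le_antisymm (unitriangularFiltration_antitone (Nat.le_succ m)) fun _ hg =>
    mem_unitriangularFiltration_succ_iff.2 ⟨hg, fun i j hij hm => absurd hm (h i j hij)⟩

/-- **`U_{ℓ(i,j)+1} = U_{ℓ(i,j)} ∩ {g_{ij} = 0}`** (levels separate positions). [cite: BruhatTits1972, §6.1] -/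
theorem mem_unitriangularFiltration_entryLevel_succ_iff {i j : Fin n} (hij : i < j) {g : GL (Fin n) F} :
    g ∈ unitriangularFiltration n F (entryLevel i j + 1) ↔
      g ∈ unitriangularFiltration n F (entryLevel i j) ∧ (g : Matrix (Fin n) (Fin n) F) i j = 0 := by
  rw [mem_unitriangularFiltration_succ_iff]
  refine and_congr_right fun _ => ⟨fun h => h i j hij rfl, fun h i' j' hij' hm => ?_⟩
  obtain ⟨rfl, rfl⟩ := entryLevel_inj hij' hij hm
  exact h

end Filtration

/-! ## §4 The entry homomorphism `U_{ℓ(i,j)} → F` and the index step along the filtration -/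

section EntryHom

variable {F : Type*} [Field F] {n : ℕ}

/-- **`(gh)_{ij} = g_{ij} + h_{ij}`** for `g, h ∈ U_m` and a position with `ℓ(i, j) ≤ m` (the entries `g_{il}`,
`i < l < j`, have level `< m`). [cite: BruhatTits1972, §6.1] -/
theorem mul_apply_eq_add_of_mem {m : ℕ} {g h : GL (Fin n) F} (hg : g ∈ unitriangularFiltration n F m)
    (hh : h ∈ unitriangularFiltration n F m) {i j : Fin n} (hij : i < j) (hm : entryLevel i j ≤ m) :
    ((g * h : GL (Fin n) F) : Matrix (Fin n) (Fin n) F) i j =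
      (g : Matrix (Fin n) (Fin n) F) i j + (h : Matrix (Fin n) (Fin n) F) i j :=
  mul_apply_eq_add hg.1 hh.1 hij fun l hil hlj => by
    rw [apply_of_entryLevel_lt_of_mem hg hil ((entryLevel_lt_right hil hlj).trans_le hm), zero_mul]

/-- **`(g⁻¹)_{ij} = -g_{ij}`** for `g ∈ U_m` and `ℓ(i, j) ≤ m`. [cite: BruhatTits1972, §6.1] -/
theorem inv_apply_eq_neg_of_mem {m : ℕ} {g : GL (Fin n) F} (hg : g ∈ unitriangularFiltration n F m)
    {i j : Fin n} (hij : i < j) (hm : entryLevel i j ≤ m) :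
    ((g⁻¹ : GL (Fin n) F) : Matrix (Fin n) (Fin n) F) i j = -(g : Matrix (Fin n) (Fin n) F) i j := by
  have h := mul_apply_eq_add_of_mem ((unitriangularFiltration n F m).inv_mem hg) hg hij hm
  rw [inv_mul_cancel, Units.val_one, Matrix.one_apply_ne hij.ne] at h
  exact eq_neg_of_add_eq_zero_left h.symm

/-- **The `(i, j)`-entry as a homomorphism `e_{ij} : U_{ℓ(i,j)} → F`** (into `Multiplicative F`).
[cite: BruhatTits1972, §6.1] [cite: Laumon1995, (4.1.3)] -/
def entryHom (i j : Fin n) (hij : i < j) :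
    ↥(unitriangularFiltration n F (entryLevel i j)) →* Multiplicative F where
  toFun g := Multiplicative.ofAdd (((g : GL (Fin n) F) : Matrix (Fin n) (Fin n) F) i j)
  map_one' := by rw [OneMemClass.coe_one, Units.val_one, Matrix.one_apply_ne hij.ne, ofAdd_zero]
  map_mul' g h := by rw [← ofAdd_add, Subgroup.coe_mul, mul_apply_eq_add_of_mem g.2 h.2 hij le_rfl]

/-- `e_{ij}(g) = g_{ij}`. [cite: Laumon1995, (4.1.3)] -/
theorem toAdd_entryHom {i j : Fin n} (hij : i < j) (g : ↥(unitriangularFiltration n F (entryLevel i j))) :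
    Multiplicative.toAdd (entryHom i j hij g) = ((g : GL (Fin n) F) : Matrix (Fin n) (Fin n) F) i j := rfl

/-- `g ∈ ker e_{ij} ↔ g_{ij} = 0`. [cite: Mazza2017, Def. 2.1] -/
theorem mem_ker_entryHom_iff {i j : Fin n} (hij : i < j) {g : ↥(unitriangularFiltration n F (entryLevel i j))} :
    g ∈ (entryHom i j hij).ker ↔ ((g : GL (Fin n) F) : Matrix (Fin n) (Fin n) F) i j = 0 := by
  rw [MonoidHom.mem_ker, ← toAdd_entryHom hij, ← toAdd_one]
  exact ⟨fun h => by rw [h], fun h => Multiplicative.toAdd.injective h⟩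

/-- **`ker e_{ij} = U_{ℓ(i,j)+1}`** (as a subgroup of `U_{ℓ(i,j)}`). [cite: BruhatTits1972, §6.1] -/
theorem ker_entryHom {i j : Fin n} (hij : i < j) :
    (entryHom (F := F) i j hij).ker =
      (unitriangularFiltration n F (entryLevel i j + 1)).subgroupOf (unitriangularFiltration n F (entryLevel i j)) := by
  ext g
  rw [mem_ker_entryHom_iff, Subgroup.mem_subgroupOf, mem_unitriangularFiltration_entryLevel_succ_iff hij]
  exact ⟨fun h => ⟨g.2, h⟩, fun h => h.2⟩

/-- The image `e_{ij}(B ∩ U_{ℓ(i,j)})` of a subgroup `B ≤ GL_n(F)`: `x` lies in it iff some `g ∈ B ∩ U_{ℓ(i,j)}` has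
`g_{ij} = x`. [cite: Laumon1995, (4.1.3)] -/
theorem mem_map_entryHom_iff {i j : Fin n} (hij : i < j) (B : Subgroup (GL (Fin n) F)) (x : Multiplicative F) :
    x ∈ ((B ⊓ unitriangularFiltration n F (entryLevel i j)).subgroupOf
        (unitriangularFiltration n F (entryLevel i j))).map (entryHom i j hij) ↔
      ∃ g ∈ B, g ∈ unitriangularFiltration n F (entryLevel i j) ∧
        (g : Matrix (Fin n) (Fin n) F) i j = Multiplicative.toAdd x := by
  constructor
  · rintro ⟨g, hg, rfl⟩
    exact ⟨g, (Subgroup.mem_subgroupOf.1 hg).1, g.2, rfl⟩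
  · rintro ⟨g, hgB, hgU, hgx⟩
    refine ⟨⟨g, hgU⟩, Subgroup.mem_subgroupOf.2 ⟨hgB, hgU⟩, ?_⟩
    rw [← ofAdd_toAdd x, ← hgx]
    rfl

/-- **THE INDEX STEP ALONG THE ENTRY FILTRATION**: for subgroups `B ≤ A` of `GL_n(F)` and a position `(i, j)` of level
`ℓ`, `[A ∩ U_ℓ : B ∩ U_ℓ] = [e_{ij}(A ∩ U_ℓ) : e_{ij}(B ∩ U_ℓ)] · [A ∩ U_{ℓ+1} : B ∩ U_{ℓ+1}]`.
[cite: Laumon1995, (4.1.3)–(4.1.4)] [cite: CartierCorvallis1979, §I.3] -/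
theorem relIndex_inf_unitriangularFiltration_eq_mul {A B : Subgroup (GL (Fin n) F)} (hBA : B ≤ A) {i j : Fin n}
    (hij : i < j) :
    (B ⊓ unitriangularFiltration n F (entryLevel i j)).relIndex (A ⊓ unitriangularFiltration n F (entryLevel i j)) =
      (((B ⊓ unitriangularFiltration n F (entryLevel i j)).subgroupOf
            (unitriangularFiltration n F (entryLevel i j))).map (entryHom i j hij)).relIndex
          (((A ⊓ unitriangularFiltration n F (entryLevel i j)).subgroupOf
            (unitriangularFiltration n F (entryLevel i j))).map (entryHom i j hij)) *
        (B ⊓ unitriangularFiltration n F (entryLevel i j + 1)).relIndex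
          (A ⊓ unitriangularFiltration n F (entryLevel i j + 1)) := by
  set U := unitriangularFiltration n F (entryLevel i j) with hU
  set U' := unitriangularFiltration n F (entryLevel i j + 1) with hU'
  set A' := A ⊓ U with hA'
  set B' := B ⊓ U with hB'def
  have hU'U : U' ≤ U := unitriangularFiltration_antitone (Nat.le_succ _)
  let f : ↥A' →* Multiplicative F := (entryHom i j hij).comp (Subgroup.inclusion (inf_le_right : A' ≤ U))
  have hf : ∀ g : ↥A', Multiplicative.toAdd (f g) = ((g : GL (Fin n) F) : Matrix (Fin n) (Fin n) F) i j := fun _ => rfl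
  rw [relIndex_eq_relIndex_map_mul_relIndex_ker A' B' f]
  -- the images
  have himg : ∀ (X : Subgroup (GL (Fin n) F)), X ≤ A' →
      (X.subgroupOf A').map f = ((X ⊓ U).subgroupOf U).map (entryHom i j hij) := by
    intro X hX
    ext x
    rw [mem_map_entryHom_iff]
    constructor
    · rintro ⟨g, hg, rfl⟩
      exact ⟨g, Subgroup.mem_subgroupOf.1 hg, (hX (Subgroup.mem_subgroupOf.1 hg)).2, (hf g).symm⟩
    · rintro ⟨g, hgX, hgU, hgx⟩
      refine ⟨⟨g, hX hgX⟩, Subgroup.mem_subgroupOf.2 hgX, ?_⟩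
      rw [← ofAdd_toAdd x, ← hgx]
      rfl
  have hB'A' : B' ≤ A' := inf_le_inf_right U hBA
  have h1 : (B'.subgroupOf A').map f = (B'.subgroupOf U).map (entryHom i j hij) := by
    rw [himg B' hB'A', inf_eq_left.2 (inf_le_right : B' ≤ U)]
  have h2 : f.range = (A'.subgroupOf U).map (entryHom i j hij) := by
    rw [MonoidHom.range_eq_map, ← Subgroup.subgroupOf_self, himg A' le_rfl, inf_eq_left.2 (inf_le_right : A' ≤ U)]
  -- the kernel
  have hker : f.ker = (A ⊓ U').subgroupOf A' := by
    ext g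
    rw [MonoidHom.mem_ker, Subgroup.mem_subgroupOf, Subgroup.mem_inf, hU',
      mem_unitriangularFiltration_entryLevel_succ_iff hij]
    constructor
    · intro h
      have h' := hf g
      rw [h, toAdd_one] at h'
      exact ⟨(Subgroup.mem_inf.1 g.2).1, (Subgroup.mem_inf.1 g.2).2, h'.symm⟩
    · intro h
      apply Multiplicative.toAdd.injective
      rw [hf, toAdd_one]
      exact h.2.2
  have h3 : B'.subgroupOf A' ⊓ f.ker = (B ⊓ U').subgroupOf A' := by
    ext g
    simp only [Subgroup.mem_inf, hker, Subgroup.mem_subgroupOf, hB'def]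
    exact ⟨fun h => ⟨h.1.1, h.2.2⟩, fun h => ⟨⟨h.1, hU'U h.2⟩, hBA h.1, h.2⟩⟩
  rw [h1, h2, h3, hker, Subgroup.relIndex_subgroupOf (inf_le_inf_left A hU'U)]

/-- If `m` is not a level the step is trivial: `[A ∩ U_m : B ∩ U_m] = [A ∩ U_{m+1} : B ∩ U_{m+1}]`.
[cite: Laumon1995, (4.1.3)–(4.1.4)] -/
theorem relIndex_inf_unitriangularFiltration_succ_eq_of_forall_ne (A B : Subgroup (GL (Fin n) F)) {m : ℕ}
    (h : ∀ i j : Fin n, i < j → entryLevel i j ≠ m) :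
    (B ⊓ unitriangularFiltration n F (m + 1)).relIndex (A ⊓ unitriangularFiltration n F (m + 1)) =
      (B ⊓ unitriangularFiltration n F m).relIndex (A ⊓ unitriangularFiltration n F m) := by
  rw [unitriangularFiltration_succ_eq_of_forall_ne h]

/-- The start of the induction: for `A, B ≤ U_n(F)`, `[A ∩ U_0 : B ∩ U_0] = [A : B]`. [cite: Laumon1995, (4.1.3)–(4.1.4)] -/
theorem relIndex_inf_unitriangularFiltration_zero {A B : Subgroup (GL (Fin n) F)}
    (hA : A ≤ upperUnitriangular (Fin n) F) (hB : B ≤ upperUnitriangular (Fin n) F) :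
    (B ⊓ unitriangularFiltration n F 0).relIndex (A ⊓ unitriangularFiltration n F 0) = B.relIndex A := by
  rw [unitriangularFiltration_zero, inf_eq_left.2 hA, inf_eq_left.2 hB]

/-- The end of the induction: `[A ∩ U_m : B ∩ U_m] = 1` for `m ≥ n²`. [cite: Laumon1995, (4.1.3)–(4.1.4)] -/
theorem relIndex_inf_unitriangularFiltration_of_mul_self_le (A B : Subgroup (GL (Fin n) F)) {m : ℕ} (hm : n * n ≤ m) :
    (B ⊓ unitriangularFiltration n F m).relIndex (A ⊓ unitriangularFiltration n F m) = 1 := by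
  rw [unitriangularFiltration_eq_bot hm, inf_bot_eq, inf_bot_eq, Subgroup.relIndex_bot_right]

end EntryHom

/-! ## §5 Products of elementary unipotents `t_{ij}(a) = 1 + aE_{ij}` -/

section Transvections

variable {F : Type*} [Field F] {n : ℕ}

/-- **`t_{ij}(a) t_{i'j'}(b) = 1 + aE_{ij} + bE_{i'j'}`** for `j ≠ i'` (`E_{ij}E_{i'j'} = 0`). [cite: Mazza2017, §2 (1)] -/
theorem coe_transvectionGL_mul_transvectionGL_of_ne {i j i' j' : Fin n} (hij : i ≠ j) (hi'j' : i' ≠ j') (h : j ≠ i')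
    (a b : F) :
    ((transvectionGL i j hij a * transvectionGL i' j' hi'j' b : GL (Fin n) F) : Matrix (Fin n) (Fin n) F) =
      1 + Matrix.single i j a + Matrix.single i' j' b := by
  rw [Units.val_mul, coe_transvectionGL, coe_transvectionGL, Matrix.transvection, Matrix.transvection, mul_add, mul_one,
    add_mul, one_mul, Matrix.single_mul_single_of_ne _ _ _ _ h, add_zero]

/-- **`t_{ic}(a) t_{ck}(b) t_{ik}(d) = 1 + aE_{ic} + bE_{ck} + (ab + d)E_{ik}`** for pairwise distinct `i, c, k`
(`E_{ic}E_{ck} = E_{ik}`; Weir's «completing the rectangle»). [cite: Mazza2017, §2 (1) and Def. 2.1] -/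
theorem coe_transvectionGL_mul_transvectionGL_mul_transvectionGL {i c k : Fin n} (hic : i ≠ c) (hck : c ≠ k)
    (hik : i ≠ k) (a b d : F) :
    ((transvectionGL i c hic a * transvectionGL c k hck b * transvectionGL i k hik d : GL (Fin n) F) :
        Matrix (Fin n) (Fin n) F) =
      1 + Matrix.single i c a + Matrix.single c k b + Matrix.single i k (a * b + d) := by
  rw [Units.val_mul, Units.val_mul, coe_transvectionGL, coe_transvectionGL, coe_transvectionGL, Matrix.transvection,
    Matrix.transvection, Matrix.transvection]
  rw [show ((1 : Matrix (Fin n) (Fin n) F) + Matrix.single i c a) * (1 + Matrix.single c k b) =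
      1 + Matrix.single i c a + Matrix.single c k b + Matrix.single i k (a * b) by
    rw [mul_add, mul_one, add_mul, one_mul, Matrix.single_mul_single_same]; abel]
  rw [mul_add, mul_one, add_mul, add_mul, add_mul, one_mul, Matrix.single_mul_single_of_ne _ _ _ _ hic.symm,
    Matrix.single_mul_single_of_ne _ _ _ _ hik.symm, Matrix.single_mul_single_of_ne _ _ _ _ hik.symm, add_zero, add_zero,
    add_zero, Matrix.single_add]
  abel

/-- The matrix of `t_{ij}(c)` is `1 + cE_{ij}`. [cite: Mazza2017, §2 (1)] -/
theorem coe_transvectionGL_eq_one_add {i j : Fin n} (hij : i ≠ j) (c : F) :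
    ((transvectionGL i j hij c : GL (Fin n) F) : Matrix (Fin n) (Fin n) F) = 1 + Matrix.single i j c := rfl

/-- Entries of `1 + X` off the support of `X`: if `X_{pq} = 0` then `(1 + X)_{pq} = δ_{pq}`. [cite: Mazza2017, §2] -/
theorem one_add_apply_of_forall {X : Matrix (Fin n) (Fin n) F} {p q : Fin n} (hX : X p q = 0) :
    (1 + X) p q = if p = q then 1 else 0 := by
  rw [Matrix.add_apply, hX, add_zero, Matrix.one_apply]

/-- Off-diagonal entries of `1 + X` are those of `X`. [cite: Mazza2017, §2] -/
theorem one_add_apply_of_ne (X : Matrix (Fin n) (Fin n) F) {p q : Fin n} (hpq : p ≠ q) : (1 + X) p q = X p q := by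
  rw [Matrix.add_apply, Matrix.one_apply_ne hpq, zero_add]

/-- **Membership of `1 + X` in `U_m` from the support of `X`**: if every non-zero entry of `X` sits at a position
`(p, q)` with `p < q` and `ℓ(p, q) ≥ m`, then an invertible matrix with matrix `1 + X` lies in `U_m` (used for products
of root elements written as `1 + ∑ a_{pq} E_{pq}`). [cite: BruhatTits1972, §6.1] -/
theorem mem_unitriangularFiltration_of_coe_eq_one_add {m : ℕ} {g : GL (Fin n) F} {X : Matrix (Fin n) (Fin n) F}
    (hg : (g : Matrix (Fin n) (Fin n) F) = 1 + X) (hX : ∀ p q, X p q ≠ 0 → p < q ∧ m ≤ entryLevel p q) :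
    g ∈ unitriangularFiltration n F m := by
  have hX' : ∀ p q, ¬(p < q ∧ m ≤ entryLevel p q) → X p q = 0 := fun p q h => by
    by_contra hne
    exact h (hX p q hne)
  refine mem_unitriangularFiltration_of_apply (fun p => ?_) (fun p q hqp => ?_) (fun p q hpq hm => ?_)
  · rw [hg, one_add_apply_of_forall (hX' p p fun h => lt_irrefl _ h.1), if_pos rfl]
  · rw [hg, one_add_apply_of_forall (hX' p q fun h => lt_asymm hqp h.1), if_neg hqp.ne']
  · rw [hg, one_add_apply_of_forall (hX' p q fun h => absurd hm (not_lt.2 h.2)), if_neg hpq.ne]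

end Transvections

end Literature.NumberTheory.Automorphic
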